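import Mathlib
import Summits.ValiantsHypothesis.ValiantsHypothesis.Theorems.NewtonTauWeak.Negative.Zonogon

/-!
Stub-ideation k=1 (FAMILY 1) for `stub_binomialNewtonTauCommon` — helper-lemma SIGNATURES only (elaboration sanity).
Regime: WEIGHTED residue (torsion) designs, one modulus `q`, arbitrary weights `g : Fin N → ZMod q`, `K = q` products.
-/

noncomputable section
open scoped BigOperators
open MvPolynomial
open Summit.ValiantsHypothesis.ValiantsHypothesis.Theorems.NewtonTauWeak.Negative (vert)

namespace Summit.ValiantsHypothesis.ValiantsHypothesis.Cruxes.NewtonTauWeak.StubIdeasK1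

/-- H-A1 (S): Davenport constant of `ZMod q` is `q` — any `q` weights have a nonempty zero-sum subfamily
(pigeonhole on prefix sums; cf. Mathlib `ZMod.erdos_ginzburg_ziv`). -/
theorem davenport_zmod (q : ℕ) [NeZero q] {ι : Type*} (s : Finset ι) (a : ι → ZMod q)
    (hs : q ≤ s.card) : ∃ t ⊆ s, t.Nonempty ∧ ∑ i ∈ t, a i = 0 := by
  sorry

/-- Canonical adjusted set: all positives except, in each weight class `γ`, its `b γ` cheapest
(key `(c j, j)`); plus, in each class, the `a γ` negatives closest to `0`. -/
def canonSet (N q : ℕ) (g : Fin N → ZMod q) (c : Fin N → ℝ) (a b : ZMod q → ℕ) : Finset (Fin N) :=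
  Finset.univ.filter fun j =>
    (0 < c j ∧ b (g j) ≤ (Finset.univ.filter fun j' : Fin N =>
        g j' = g j ∧ 0 < c j' ∧ (c j' < c j ∨ (c j' = c j ∧ j' < j))).card) ∨
    (c j < 0 ∧ (Finset.univ.filter fun j' : Fin N =>
        g j' = g j ∧ c j' < 0 ∧ (c j < c j' ∨ (c j' = c j ∧ j' < j))).card < a (g j))

/-- H-A2 (M): WEIGHTED exchange normal form — a residue-admissible maximiser has the value of a canonical
set whose total number of adjustments is `≤ q - 1` (Davenport: `q` adjustments contain a zero-sum subfamily,
undoing it is admissible and strictly better; within a class the cheapest adjustments are best).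
Generalises the landed `stub_residueNormalForm` (block-popcount = constant weight per block). -/
theorem weightedResidue_normalForm (N q : ℕ) [NeZero q] (g : Fin N → ZMod q) (r : ZMod q)
    (c : Fin N → ℝ) (hc : ∀ j, c j ≠ 0) (J : Finset (Fin N)) (hJ : ∑ j ∈ J, g j = r)
    (hmax : ∀ J' : Finset (Fin N), ∑ j ∈ J', g j = r → ∑ j ∈ J', c j ≤ ∑ j ∈ J, c j) :
    ∃ a b : ZMod q → ℕ, (∑ γ, (a γ + b γ)) ≤ q - 1 ∧
      ∑ j ∈ canonSet N q g c a b, g j = r ∧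
      ∑ j ∈ canonSet N q g c a b, c j = ∑ j ∈ J, c j := by
  sorry

/-- H-A3 (L; assembly = that of `stub_residueDesignHull`): hull vertices of a WEIGHTED residue level set are
`≤ #sign-cells × #count-vectors`: `(4(N²+N)+5) · C(3q-1, q-1)` — polynomial in `N`, `2^{O(q)}` in `q = K`. -/
theorem weightedResidue_hull_le (N q : ℕ) [NeZero q] (g : Fin N → ZMod q) (r : ZMod q)
    (d : Fin N → (Fin 2 →₀ ℕ)) (hd : ∀ j, d j ≠ 0) :
    (Set.extremePoints ℝ (convexHull ℝ ((fun e : Fin 2 →₀ ℕ => fun i : Fin 2 => ((e i : ℕ) : ℝ)) ''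
      (((Finset.univ.filter fun J : Finset (Fin N) => ∑ j ∈ J, g j = r).image
        fun J => ∑ j ∈ J, d j : Finset (Fin 2 →₀ ℕ)) : Set (Fin 2 →₀ ℕ))))).ncard ≤
      (4 * (N * N + N) + 5) * Nat.choose (3 * q - 1) (q - 1) := by
  sorry

/-- H-A4 (M given H-A3): the T2 INSTANCE — on a dissociated list the weighted torsion design
`(1/q) Σ_{θ<q} ζ^{-θ r} Π_j (1 − ζ^{θ g_j} ρ_j X^{d_j})` (`K = q` products) has support exactly the level set
`{Σ_J d_j : Σ_J g_j = r}` (character orthogonality), hence the same vertex bound. -/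
theorem weightedResidueDesign_T2 (N q : ℕ) [NeZero q] (g : Fin N → ZMod q) (r : ZMod q)
    (ζ : ℂ) (hζ : IsPrimitiveRoot ζ q) (ρ : Fin N → ℂ) (hρ : ∀ j, ρ j ≠ 0)
    (d : Fin N → (Fin 2 →₀ ℕ)) (hd : ∀ j, d j ≠ 0)
    (hdis : ∀ J J' : Finset (Fin N), ∑ j ∈ J, d j = ∑ j ∈ J', d j → J = J') :
    vert (∑ θ : Fin q, C (ζ⁻¹ ^ ((θ : ℕ) * r.val) / (q : ℂ)) *
        ∏ j, (1 - C (ζ ^ ((θ : ℕ) * (g j).val) * ρ j) * monomial (d j) 1)) ≤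
      (4 * (N * N + N) + 5) * Nat.choose (3 * q - 1) (q - 1) := by
  sorry

/-- K-A (RESEARCH PIECE, open; typed target): K-uniform polynomiality for weighted residue level sets.
Equivalent (up to the factor `4(N²+N)+5`) to a `q`-only KERNEL statement: per sign-cell the optimum ranges over
the lower hull of `{Σ_{T} v_t : T ⊆ kernel of ≤ 2q(q-1) vectors, |T| ≤ q-1, Σ_T g_t = ρ}`. -/
def WeightedResiduePoly : Prop :=
  ∃ b : ℕ, ∀ (N q : ℕ) [NeZero q] (g : Fin N → ZMod q) (r : ZMod q) (d : Fin N → (Fin 2 →₀ ℕ)),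
    (∀ j, d j ≠ 0) →
    (Set.extremePoints ℝ (convexHull ℝ ((fun e : Fin 2 →₀ ℕ => fun i : Fin 2 => ((e i : ℕ) : ℝ)) ''
      (((Finset.univ.filter fun J : Finset (Fin N) => ∑ j ∈ J, g j = r).image
        fun J => ∑ j ∈ J, d j : Finset (Fin 2 →₀ ℕ)) : Set (Fin 2 →₀ ℕ))))).ncard ≤ (N * q + 2) ^ b

/-- H-B1 (L/XL, Gusfield-type halving on the per-cell class DAG; typed target): quasi-polynomial in `q`,
polynomial in `N`. -/
def WeightedResidueQuasi : Prop :=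
  ∃ b : ℕ, ∀ (N q : ℕ) [NeZero q] (g : Fin N → ZMod q) (r : ZMod q) (d : Fin N → (Fin 2 →₀ ℕ)),
    (∀ j, d j ≠ 0) →
    (Set.extremePoints ℝ (convexHull ℝ ((fun e : Fin 2 →₀ ℕ => fun i : Fin 2 => ((e i : ℕ) : ℝ)) ''
      (((Finset.univ.filter fun J : Finset (Fin N) => ∑ j ∈ J, g j = r).image
        fun J => ∑ j ∈ J, d j : Finset (Fin 2 →₀ ℕ)) : Set (Fin 2 →₀ ℕ))))).ncard ≤
      (4 * (N * N + N) + 5) * (q + 2) ^ (b * Nat.clog 2 (q + 2))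

end Summit.ValiantsHypothesis.ValiantsHypothesis.Cruxes.NewtonTauWeak.StubIdeasK1
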